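import Literature.IUT.HodgeTheaters.PiAvatarLocalDatumGood
import Literature.IUT.HodgeTheaters.PiAvatarLocalDatumBad
import Literature.IUT.HodgeTheaters.PiAvatarPlaceKit
import Literature.IUT.HodgeTheaters.PiAvatarBaseKitLaws
import Literature.IUT.HodgeTheaters.InitialThetaDataLocalGalois
import Mathlib.NumberTheory.NumberField.Completion.FinitePlace
import HarnessLib

/-!
# KIT-INSTANCE-SPEC P5-binding (IV-b, the WIRING): the local datum of EVERY `v̲ ∈ V̲` from the places of `K` — decomposition groups at
# finite places, the SHAPE-OF-RECORD pairs at bad places, the A3-INTERFACE convention at archimedean places — and the resulting genuine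
# base kit `InitialThetaData.baseKit` / place kit `InitialThetaData.placeKit` ([IUTchI] Def 3.1 (e)(f), Def 6.1; defs — post-freeze additive
# D13, not a cone member)

S. Mochizuki, *Inter-universal Teichmüller theory I*, kurims manuscript (May 2020), Def 3.1 (e) p. 62–63 («For each `v̲ ∈ V(K)` … the
various profinite groups `Π_{(−)v̲}` admit natural outer surjections onto the decomposition group `G_v̲ ⊆ G_K` … If `v̲ ∈ V̲^bad`, then …
`Π_v̲ := Π^tp_{X̲̳_v̲}`»), (f) p. 63 («if `v̲ ∈ V̲^good`, then … `Π_v̲ := Π_{X̲→_v̲}`»), Def 3.1 (a) p. 61 (`√−1 ∈ F`: every archimedean place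
of `K` is complex, its decomposition group trivial), Def 6.1 (ii)–(vii) pp. 156–159 ([IUTchI] Def 3.1 (e) p.62) [claim: Mochizuki2012, status: disputed]
(D-0012 claim key, series status DISPUTED — a construction over abc-iut-L5-t2's REAL `InitialThetaData` and place API
(`InitialThetaDataLocalGalois`: `decompositionSubgroupGF`, `localEmb`); nothing of the series is asserted, no side is taken on [IUTchIII] Cor. 3.12).

## What is built
* `decompAt v` — the decomposition group `G_v̲ ≤ G_F` attached to an index `v : D.IndexCopy` (`V̲ ≅ IndexCopy`): at a finite place `w` the image
  of `Gal(K̄_w/K_w) → G_F` at the completion `K_w` (abc-iut-L5-t2 `decompositionSubgroupGF F (w.adicCompletion K) (localEmb _)`), at an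
  archimedean place `⊥` (complex place, `√−1 ∈ F`; A3-INTERFACE convention of RULINGS #57 (3) R3: the Aut-holomorphic structure of Ex 3.4 is NOT
  modelled);
* `BadPairAt v` — the SHAPE-OF-RECORD binder DATA of a bad index (G-L5t4g3-2 (iii), RULINGS #36 (4): `H ≤ H′ ≤ Π_{C̲_K}`, `[H′:H] = 2`,
  `H′ ∩ Π_{X̲_K} ≤ H`) lying over `G_v̲` (`H ≤ Π_{X̲_K} ∩ augGF⁻¹ G_v̲`, `augGF(H) = G_K ∩ G_v̲`) — interface DATA (profinite avatars of
  `Π^tp_{X̲̳_v̲} ≤ Π^tp_{C̲̳_v̲}`), supplied by the L3/tempered lane, never asserted;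
* `localGroupAt B v` — `Π_v̲`: the pair's `H` at bad indices, `Π_{X̲→_K} ∩ augGF⁻¹ G_v̲` otherwise; `localDatumAt hA B Λ v : D.LocalDatum CG hS`
  (`ofBad` / `ofGood`, p445323 / p444931) under a family `Λ v : LocalArrowLaw (localGroupAt B v)` (G-L5t4g4-1);
* **`InitialThetaData.baseKit … : PMBaseKit.{w} l`** and **`InitialThetaData.placeKit … : PlaceKit D`** — the genuine [IUTchI] §6 base kit of the
  initial Θ-data over `V̲` (`baseKitOfData` / `placeKitOfData`, p444202 / p445233, at `δ := localDatumAt …`), with the laws (α) `phiEllSync_baseKit`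
  and (β) `negCompatModel_baseKit` (p444756). BINDERS of record: `CG`, `hS`, `[Normal]`/`hsurj` (t8 `TorsionMonodromy`), `hA` (t1 `ArrowCoveringClaims`),
  the bad-pair family `B`, the local-arrow-law family `Λ`; instances `[IsScalarTower F K Fbar] [Normal K Fbar]` (= `D.isScalarTower`, `D.normal_K`).
No instance declared, no notation; typed ≠ inhabited ≠ proved; binder ≠ fact.
-/

noncomputable section

namespace Literature.IUT.HodgeTheaters

open CategoryTheory NumberField

universe u v w

section PlaceData

variable {F : Type u} {K : Type v} {Fbar : Type w} [Field F] [NumberField F] [Field K] [NumberField K]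
  [Algebra F K] [Field Fbar] [Algebra F Fbar] [Algebra K Fbar]
  {E : WeierstrassCurve F} [E.IsElliptic] {l : ℕ} {Pb : BadPlacePredicates K}
  (D : InitialThetaData F K Fbar E l Pb)

namespace InitialThetaData

/-! ### Decomposition groups attached to indices -/

/-- **`G_v̲ ≤ G_F` at an index** (Def 3.1 (e)): at a finite place `w` of `K`, the decomposition group of `K_w` — the image of
`Gal(K̄_w/K_w) → G_F` for the completion `K_w` and a chosen `K`-embedding `F̄ → K̄_w`; at an archimedean place `⊥` (every archimedean place of
`K ⊇ F ∋ √−1` is complex; A3-INTERFACE convention). ([IUTchI] Def 3.1 (e) p.62) [claim: Mochizuki2012, status: disputed] -/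
def decompAt (v : D.IndexCopy) : Subgroup (Fbar ≃ₐ[F] Fbar) :=
  haveI := D.isScalarTower
  haveI := D.normal_K
  match D.indexCopyVal v with
  | Sum.inl _ => ⊥
  | Sum.inr w => decompositionSubgroupGF F ((NumberField.FinitePlace.maximalIdeal w).adicCompletion K)
      (localEmb (K := K) (Fbar := Fbar) (AlgebraicClosure ((NumberField.FinitePlace.maximalIdeal w).adicCompletion K)))

/-! ### The bad-pair binder family and the local groups -/

/-- **The SHAPE-OF-RECORD datum of a bad index** (G-L5t4g3-2 (iii); Def 3.1 (e) «`Π_v̲ := Π^tp_{X̲̳_v̲}`», `Π_{X̲̳_v̲} ⊆ Π_{C̲̳_v̲} ⊆ Π_{C_v̲}`): the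
profinite avatars `H = Π_{X̲̳_v̲} ≤ H′ = Π_{C̲̳_v̲}` inside `Π_{C_F}`, index `2`, `H′ ≤ Π_{C̲_K}`, `H′ ∩ Π_{X̲_K} ≤ H`, lying over `G_v̲`. Interface DATA for
the L3/tempered lane, never asserted. ([IUTchI] Def 3.1 (e) p.63) [claim: Mochizuki2012, status: disputed] -/
structure BadPairAt (v : D.IndexCopy) : Type w where
  /-- `Π_{X̲̳_v̲}` (profinite avatar) -/
  H : Subgroup D.PiC
  /-- `Π_{C̲̳_v̲}` (profinite avatar) -/
  H' : Subgroup D.PiC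
  /-- `Π_{X̲̳_v̲} ≤ Π_{C̲̳_v̲}` -/
  le : H ≤ H'
  /-- index `2` -/
  relIndex_eq_two : H.relIndex H' = 2
  /-- `Π_{C̲̳_v̲} ≤ Π_{C̲_K}` -/
  le_PiCund : H' ≤ D.PiCund
  /-- `Π_{C̲̳_v̲} ∩ Π_{X̲_K} ≤ Π_{X̲̳_v̲}` -/
  inf_le : H' ⊓ D.PiXund ≤ H
  /-- `Π_{X̲̳_v̲} ≤ Π_{X̲_K} ∩ augGF⁻¹ G_v̲` (it lies over the decomposition group of `v̲`) -/
  le_loc : H ≤ D.PiXund ⊓ (D.decompAt v).comap D.augGF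
  /-- `augGF(Π_{X̲̳_v̲}) = G_K ∩ G_v̲` (it surjects onto the local Galois group) -/
  map_augGF : H.map D.augGF = galoisSubgroupOf F K Fbar ⊓ D.decompAt v

variable (B : ∀ v, v ∈ D.indexCopyBad → D.BadPairAt v)

open Classical in
/-- **`Π_v̲` at an index**: the pair's `Π_{X̲̳_v̲}` at bad indices (Def 3.1 (e)), `Π_{X̲→_K} ∩ augGF⁻¹ G_v̲` otherwise (Def 3.1 (f); archimedean:
A3-INTERFACE). ([IUTchI] Def 3.1 (f) p.63) [claim: Mochizuki2012, status: disputed] -/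
def localGroupAt (v : D.IndexCopy) : Subgroup D.PiC :=
  if h : v ∈ D.indexCopyBad then (B v h).H else D.PiXarrow ⊓ (D.decompAt v).comap D.augGF

/-- At a bad index `Π_v̲ = (B v).H`. ([IUTchI] Def 3.1 (e) p.63) [claim: Mochizuki2012, status: disputed] -/
theorem localGroupAt_of_mem {v : D.IndexCopy} (h : v ∈ D.indexCopyBad) : D.localGroupAt B v = (B v h).H := by
  rw [localGroupAt, dif_pos h]

/-- At a good index `Π_v̲ = Π_{X̲→_K} ∩ augGF⁻¹ G_v̲`. ([IUTchI] Def 3.1 (f) p.63) [claim: Mochizuki2012, status: disputed] -/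
theorem localGroupAt_of_not_mem {v : D.IndexCopy} (h : v ∉ D.indexCopyBad) :
    D.localGroupAt B v = D.PiXarrow ⊓ (D.decompAt v).comap D.augGF := by
  rw [localGroupAt, dif_neg h]

variable (CG : D.geom.pe.CuspGalois) (hS : D.CuspClassesNormaliserStable) [Fact l.Prime]

open Classical in
/-- **The local datum at an index** (`ofBad` at bad indices, `ofGood` elsewhere) under the local-arrow-law family `Λ` and t1's §1 claims `hA`.
([IUTchI] Def 6.1 (ii) p.156) [claim: Mochizuki2012, status: disputed] -/
def localDatumAt (hA : D.geom.pe.ArrowCoveringClaims)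
    (Λ : ∀ v, D.LocalArrowLaw CG hS (D.localGroupAt B v)) (v : D.IndexCopy) : D.LocalDatum CG hS :=
  if h : v ∈ D.indexCopyBad then
    LocalDatum.ofBad (B v h).le (B v h).relIndex_eq_two (B v h).le_PiCund (B v h).inf_le (D.decompAt v) (B v h).le_loc (B v h).map_augGF
      (D.localGroupAt_of_mem B h ▸ Λ v)
  else
    LocalDatum.ofGood (D.decompAt v) (D.localGroupAt_of_not_mem B h ▸ Λ v) hA

/-- The local group of the datum at an index is `localGroupAt`. ([IUTchI] Def 3.1 (e) p.62) [claim: Mochizuki2012, status: disputed] -/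
theorem localDatumAt_H (hA : D.geom.pe.ArrowCoveringClaims)
    (Λ : ∀ v, D.LocalArrowLaw CG hS (D.localGroupAt B v)) (v : D.IndexCopy) :
    (D.localDatumAt B CG hS hA Λ v).H = D.localGroupAt B v := by
  by_cases h : v ∈ D.indexCopyBad
  · rw [localDatumAt, dif_pos h, D.localGroupAt_of_mem B h]
    rfl
  · rw [localDatumAt, dif_neg h, D.localGroupAt_of_not_mem B h]
    rfl

/-- The `±`-overgroup of the datum at an index is `Π_{X̲_K} ∩ augGF⁻¹ G_v̲` (type (1,l-tors)). ([IUTchI] Def 6.1 (ii) p.156) [claim: Mochizuki2012, status: disputed] -/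
theorem localDatumAt_Hund (hA : D.geom.pe.ArrowCoveringClaims)
    (Λ : ∀ v, D.LocalArrowLaw CG hS (D.localGroupAt B v)) (v : D.IndexCopy) :
    (D.localDatumAt B CG hS hA Λ v).Hund = D.PiXund ⊓ (D.decompAt v).comap D.augGF := by
  by_cases h : v ∈ D.indexCopyBad
  · rw [localDatumAt, dif_pos h]
    rfl
  · rw [localDatumAt, dif_neg h]
    rfl

/-! ### The genuine base kit and place kit of the initial Θ-data -/

variable [(D.PiXund.subgroupOf D.PiXK).Normal] (hsurj : Function.Surjective D.toFlStarGlobal)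
  (hA : D.geom.pe.ArrowCoveringClaims) (Λ : ∀ v, D.LocalArrowLaw CG hS (D.localGroupAt B v))

open Classical in
/-- **THE GENUINE BASE KIT `𝒟`-DATA OF [IUTchI] §6 FOR THE INITIAL Θ-DATA `D`** (Def 6.1 (ii)–(vii) over `V̲`): `baseKitOfData` (p444202) at
the local data wired from the places of `K`. ([IUTchI] Def 6.1 (ii)-(vii) pp.156-159) [claim: Mochizuki2012, status: disputed] -/
def baseKit : PMBaseKit.{w} l :=
  D.baseKitOfData CG hS hsurj D.indexCopyBad D.indexCopyArc (D.localDatumAt B CG hS hA Λ)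

open Classical in
/-- **The genuine PLACE KIT of the initial Θ-data** (its kit is `baseKit`, indexed by `V̲`). ([IUTchI] Def 3.1 (e) p.62) [claim: Mochizuki2012, status: disputed] -/
def placeKit : PlaceKit.{w} D :=
  D.placeKitOfData CG hS hsurj (D.localDatumAt B CG hS hA Λ)

/-- The kit of the genuine place kit is `baseKit`. ([IUTchI] Def 6.1 (ii) p.156) [claim: Mochizuki2012, status: disputed] -/
theorem placeKit_kit : (D.placeKit B CG hS hsurj hA Λ).kit = D.baseKit B CG hS hsurj hA Λ := rfl

open Classical in
/-- **(α) at the genuine kit of the initial Θ-data.** ([IUTchI] Ex 6.3 (i) p.161) [claim: Mochizuki2012, status: disputed] -/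
theorem phiEllSync_baseKit : PMBaseKit.Ex63.PhiEllSync (D.baseKit B CG hS hsurj hA Λ) :=
  D.phiEllSync_baseKitOfData CG hS hsurj _ _ _

open Classical in
/-- **(β) at the genuine kit of the initial Θ-data.** ([IUTchI] Ex 6.3 (ii) p.161) [claim: Mochizuki2012, status: disputed] -/
theorem negCompatModel_baseKit : PMBaseKit.Ex63.NegCompatModel (D.baseKit B CG hS hsurj hA Λ) :=
  D.negCompatModel_baseKitOfData CG hS hsurj _ _ _

end InitialThetaData

end PlaceData

end Literature.IUT.HodgeTheaters
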